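import Summits.QuantumFields.YangMills.Theorems.BalabanUVNodesN08AxialDecimationForgetsSelected

/-!
# BalabanUVNodes ∕ N08 — FAR COARSE VARIABLES ARE FRESH: along the axial (decimation) averaging, for any set `Far` of coarse bonds carrying one free bond per line, the far
# coarse variables are PRODUCT HAAR AND INDEPENDENT of the density and of the near coarse variables — the LOCALITY ENGINE of the no-stacking mechanism (files 32–33: forgetting;
# here: a density that is local near a defect is transported to a density that is local near the defect's image, Haar elsewhere)

Track A, DAG node N08 = T. Bałaban, CMP **102** (1985) 255–275 [Balaban1985UV3]: (2) p. 256, (10) p. 258, (48)–(49) p. 268 (the split of the fine integral), Thm 1 (5) p. 257 (bounds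
extensive in the CURRENT lattice); [Balaban1985Averaging] (15) p. 19 (the axial factor); [Balaban1987RG1] (0.4) p. 253 (the guard).  Cell `pub-ymgap`, width seat `pub-ymgap-dag-n08-w1`
(g6), W-SEAT-START-LIST §n08 item 1 successor piece (o28) = file 34; `--supports` K1⁹ `StabilityBRunRowsAtRecordR13SepCoPHV` (stmt-QuantumFields-27364, KEY MAP v2; helper).
Companion of file 33 (`…N08AxialDecimationForgetsSelected`: `Far` = all coarse bonds ⇒ `T^{axial}ρ = ∫ρ`), whose bookkeeping (`pathProd_split`, `splitEquiv_symm_apply`,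
`piCongrLeft_const_apply`, the tree's `Spine.NE7.line_inj`) it imports BY NAME.

THE POINT (located, count-neutral).  Road (ii)'s residual (G2) in `N08-TRIVIAL-HISTORY-WORST.md` §3b: after one step the new excess density must again be LOCAL (so that the next
decimation forgets it).  This file proves the locality engine for the decimation part: let `Far` be ANY set of coarse bonds with a selection `τ` of one bond per far line, and let
the integrable density `ρ` not depend on the far-selected bonds (it may depend on EVERYTHING else — all near lines entirely, all other bonds of the far lines).  Then, along the
axial average, **conditionally on everything near, the far coarse variables are product Haar**: for every bounded measurable coarse observable `f`,
`∫ ρ(U)·f(Ū) dU = ∫ ρ(U)·(A_Far f)(Ū) dU` with `(A_Far f)(V) = ∫ f(V↾Farᶜ ⊔ v) dHaar^{Far}(v)` the far-average (§3, written inline), and in product form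
`∫ ρ·f₁(Ū)·f₂(Ū) dU = (∫ ρ·f₁(Ū) dU)·(∫ f₂ dV)` for `f₁` local off `Far`, `f₂` local on `Far` (§3).  Read for a defect: a density localised near a cluster `D` of fine bonds is
transported by decimation to a measure whose far part (every line not meeting `D`, one free bond each) is exactly product Haar, independent of the near part — the image defect is
localised near the lines meeting `D`.  Mechanism: Fubini over far-selected ∕ other bonds (`FibreSplit`); with the other bonds frozen, near coarse variables are frozen and far ones are
`a_c·w(line c (τ c))·b_c`, a reindexed two-sided translate of fresh Haar variables (file 33 §2's computation, localised).

WHAT THIS FILE PROVES (kernel; theorems only, 0 def; [folklore] measure theory + lattice bookkeeping; nothing of the papers asserted).  Standing range `j + 1 ≤ m + K`, any `G` with the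
carrier's measurability instances:
* §1 `axialAvg_congr_line` (the line product depends only on the bonds of its line).
* §2 `integral_far_eq` — a coarse observable local on `Far` integrates against the far factor alone: `∫ f₂(x ⊔ v) dHaar^{Far}(v) = ∫ f₂ dV` for every frozen `x`.
* §3 ★★★ `integral_mul_comp_axial_eq_farAvg` — **the far-average identity** `∫ ρ·f(Ū) dU = ∫ ρ·(A_Far f)(Ū) dU` (general bounded measurable `f`); ★★★ `integral_mul_far_eq` — **the
  independence identity** `∫ ρ·f₁(Ū)·f₂(Ū) dU = (∫ ρ·f₁(Ū) dU)·(∫ f₂ dV)` (`f₁` local off `Far`, `f₂` local on `Far`).  File 33's `isRT_axial_const_of_localOff` is the case `Far = ⊤`, `f₁ ≡ 1`.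

HONEST FRAMING: count-neutral helper; nothing about the guarded (non-axial) part of print's averaging, no density bound, no statement about the actual iterates `f_k` — (a)′ ∕ (F) ∕ E6′
NOT decided; `PrintedUV3V` NOT proved; N08 NOT discharged; one finite 𝕋⁴ programme at fixed ε, Bałaban AS PRINTED — R4 closes the conditional finite-𝕋⁴ rung `BalabanLadder.UV` only;
the Yang–Mills mass gap (Clay) is NOT proved by any of this; nothing continuum ∕ ℝ⁴ ∕ OS.  No `sorry`, standard axioms.
-/

noncomputable section

open MeasureTheory
open scoped ENNReal

namespace Summit.QuantumFields.YangMills.BalabanUVNodes.N08AxialDecimationFarFresh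

open Literature.MathematicalPhysics.QuantumFieldTheory.Balaban1983to89
open Literature.MathematicalPhysics.QuantumFieldTheory.Balaban1983to89.AveragingRT
open Summit.QuantumFields.Balaban3D.Proofs
open Summit.QuantumFields.Balaban3D.Carriers
open Summit.QuantumFields.BalabanUV.T4Continuum.Spine.NE7 (line_inj)
open Summit.QuantumFields.YangMills.BalabanUVNodes.N08AxialDecimationForgetsSelected (pathProd_split splitEquiv_symm_apply piCongrLeft_const_apply)

/-! ## §1 The line product depends only on its line -/
section Geometry

variable {P : Params} {j : ℕ} {G : Type*} [GaugeGroup G]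

/-- The line product depends only on the bonds of its line: `W`, `W′` agreeing on `line c s`, `s < L` have the same `W̄(c)`. [folklore] -/
theorem axialAvg_congr_line (c : PBond P (j + 1)) {W W' : GaugeField P j G} (h : ∀ s, s < P.L → W (line c s) = W' (line c s)) :
    axialAvg W c = axialAvg W' c := by
  have : ∀ n, n ≤ P.L → pathProd W c n = pathProd W' c n := by
    intro n hn
    induction n with
    | zero => rfl
    | succ n ih => simp only [pathProd, ih (by omega), h n (by omega)]
  exact this _ le_rfl

end Geometry



/-! ## §2–§3 Far coarse variables are fresh Haar -/
section FarFresh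

variable {P : Params} {j : ℕ} {G : Type} [GaugeGroup G] [MeasurableSpace G] [HaarData G] [MeasurableMul₂ G]

omit [MeasurableMul₂ G] in
/-- **A FAR-LOCAL coarse observable integrates against the Far factor alone**: if `f₂` is local on the coarse bonds in `Far`, then for every frozen `x` off `Far`,
`∫ v, f₂(joinC(x, v)) dHaar^{Far}(v) = ∫ f₂ dV` (Fubini over the coarse splitting; the other factor is a probability). [folklore] -/
theorem integral_far_eq (Far : PBond P (j + 1) → Prop) [DecidablePred Far] (f₂ : GaugeField P (j + 1) G → ℝ) (hf₂ : Measurable f₂) (C : ℝ) (hC : ∀ V, |f₂ V| ≤ C)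
    (hloc₂ : ∀ V V' : GaugeField P (j + 1) G, (∀ c, Far c → V c = V' c) → f₂ V = f₂ V')
    (x : {c : PBond P (j + 1) // ¬ Far c} → G) :
    ∫ v, f₂ ((FibreSplit.splitEquiv Far (P := P) (G := G)).symm (x, v)) ∂(Measure.pi fun _ : {c : PBond P (j + 1) // ¬¬ Far c} => (HaarData.haar : Measure G)) =
      ∫ V, f₂ V ∂(fieldMeasure P (j + 1) G) := by
  have hint : Integrable f₂ (fieldMeasure P (j + 1) G) := integrable_of_abs_le hf₂ C hC
  rw [FibreSplit.integral_fieldMeasure_split Far f₂ hint]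
  -- the inner integral does not depend on the outer variable
  have hconst : ∀ x' : {c : PBond P (j + 1) // ¬ Far c} → G,
      ∫ v, f₂ ((FibreSplit.splitEquiv Far (P := P) (G := G)).symm (x', v)) ∂(Measure.pi fun _ : {c : PBond P (j + 1) // ¬¬ Far c} => (HaarData.haar : Measure G)) =
      ∫ v, f₂ ((FibreSplit.splitEquiv Far (P := P) (G := G)).symm (x, v)) ∂(Measure.pi fun _ : {c : PBond P (j + 1) // ¬¬ Far c} => (HaarData.haar : Measure G)) := by
    intro x'
    refine integral_congr_ae (Filter.Eventually.of_forall fun v => hloc₂ _ _ fun c hc => ?_)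
    rw [splitEquiv_symm_apply, splitEquiv_symm_apply, dif_neg (not_not.2 hc), dif_neg (not_not.2 hc)]
  simp_rw [hconst]
  rw [integral_const, probReal_univ, one_smul]

/-- ★★★ **FAR COARSE VARIABLES ARE FRESH HAAR, INDEPENDENT OF EVERYTHING ELSE** (the locality engine of the no-stacking mechanism): let `Far` be a set of coarse bonds with a
selection `τ` of one bond per FAR line (`τ c < L`), and let the integrable density `ρ` not depend on the far-selected bonds `{line c (τ c) : c ∈ Far}`.  Then for every bounded
measurable `f₁` local OFF `Far` and `f₂` local ON `Far`:  `∫ ρ(U)·f₁(Ū)·f₂(Ū) dU = (∫ ρ(U)·f₁(Ū) dU)·(∫ f₂ dV)` along the axial average — the far coarse variables are distributed as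
product Haar and independent of the density and of the near coarse variables.  (File 33 = the case `Far` = all coarse bonds, `f₁ ≡ 1`.) [cite: Balaban1985UV3, (10) p.258 + (48)–(49) p.268 (bookkeeping); Balaban1985Averaging, (15) p.19] -/
theorem integral_mul_far_eq (hj : j + 1 ≤ P.m + P.K) (Far : PBond P (j + 1) → Prop) [DecidablePred Far] (τ : PBond P (j + 1) → ℕ) (hτ : ∀ c, Far c → τ c < P.L)
    [DecidablePred fun b : PBond P j => ∃ c, Far c ∧ line c (τ c) = b]
    (ρ : Density P j G) (hρ : Integrable ρ (fieldMeasure P j G))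
    (hloc : ∀ W W' : GaugeField P j G, (∀ b, (¬ ∃ c, Far c ∧ line c (τ c) = b) → W b = W' b) → ρ W = ρ W')
    (f₁ f₂ : GaugeField P (j + 1) G → ℝ) (hf₁ : Measurable f₁) (hf₂ : Measurable f₂) (C₁ C₂ : ℝ) (hC₁ : ∀ V, |f₁ V| ≤ C₁) (hC₂ : ∀ V, |f₂ V| ≤ C₂)
    (hloc₁ : ∀ V V' : GaugeField P (j + 1) G, (∀ c, ¬ Far c → V c = V' c) → f₁ V = f₁ V')
    (hloc₂ : ∀ V V' : GaugeField P (j + 1) G, (∀ c, Far c → V c = V' c) → f₂ V = f₂ V') :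
    ∫ U, ρ U * (f₁ (axialAvg U) * f₂ (axialAvg U)) ∂(fieldMeasure P j G) =
      (∫ U, ρ U * f₁ (axialAvg U) ∂(fieldMeasure P j G)) * ∫ V, f₂ V ∂(fieldMeasure P (j + 1) G) := by
  set B : PBond P j → Prop := fun b => ∃ c, Far c ∧ line c (τ c) = b with hB
  -- abbreviations for the join and its frozen version
  have hJ : ∀ (wZ : {b : PBond P j // ¬ B b} → G) (wB : {b : PBond P j // ¬¬ B b} → G) (b : PBond P j), ¬ B b →
      (FibreSplit.splitEquiv B (P := P) (G := G)).symm (wZ, wB) b = (FibreSplit.splitEquiv B (P := P) (G := G)).symm (wZ, fun _ => 1) b := by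
    intro wZ wB b hb
    rw [splitEquiv_symm_apply, splitEquiv_symm_apply, dif_pos hb, dif_pos hb]
  -- (i) `ρ` is frozen
  have hρc : ∀ (wZ : {b : PBond P j // ¬ B b} → G) (wB : {b : PBond P j // ¬¬ B b} → G),
      ρ ((FibreSplit.splitEquiv B (P := P) (G := G)).symm (wZ, wB)) = ρ ((FibreSplit.splitEquiv B (P := P) (G := G)).symm (wZ, fun _ => 1)) :=
    fun wZ wB => hloc _ _ fun b hb => hJ wZ wB b hb
  -- (ii) the non-far coarse variables are frozen: no bond of a non-far line is selected
  have hnotB : ∀ c, ¬ Far c → ∀ s, s < P.L → ¬ B (line c s) := by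
    rintro c hc s hs ⟨c', hc', h⟩
    obtain ⟨h1, -⟩ := line_inj hj (hτ c' hc') hs h
    exact hc (h1 ▸ hc')
  have hf₁c : ∀ (wZ : {b : PBond P j // ¬ B b} → G) (wB : {b : PBond P j // ¬¬ B b} → G),
      f₁ (axialAvg ((FibreSplit.splitEquiv B (P := P) (G := G)).symm (wZ, wB))) = f₁ (axialAvg ((FibreSplit.splitEquiv B (P := P) (G := G)).symm (wZ, fun _ => 1))) :=
    fun wZ wB => hloc₁ _ _ fun c hc => axialAvg_congr_line c fun s hs => hJ wZ wB _ (hnotB c hc s hs)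
  -- (iii) the far coarse variables: reindexing + two-sided translation of fresh Haar variables
  have hsel_inj : ∀ c c', Far c → Far c' → line c (τ c) = line c' (τ c') → c = c' :=
    fun c c' hc hc' h => (line_inj hj (hτ c hc) (hτ c' hc') h).1
  let e : {c : PBond P (j + 1) // ¬¬ Far c} ≃ {b : PBond P j // ¬¬ B b} :=
    Equiv.ofBijective (fun c => ⟨line c.1 (τ c.1), not_not.2 ⟨c.1, not_not.1 c.2, rfl⟩⟩)
      ⟨fun c c' h => Subtype.ext (hsel_inj c.1 c'.1 (not_not.1 c.2) (not_not.1 c'.2) (congrArg Subtype.val h)), fun b => by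
        obtain ⟨c, hc, hcb⟩ := not_not.1 b.2
        exact ⟨⟨c, not_not.2 hc⟩, Subtype.ext hcb⟩⟩
  choose a b hab hinv using fun c : {c : PBond P (j + 1) // ¬¬ Far c} => pathProd_split (P := P) (G := G) c.1 (hτ c.1 (not_not.1 c.2))
  have hfar : ∀ (wZ : {b : PBond P j // ¬ B b} → G),
      ∫ wB, f₂ (axialAvg ((FibreSplit.splitEquiv B (P := P) (G := G)).symm (wZ, wB))) ∂(Measure.pi fun _ : {b : PBond P j // ¬¬ B b} => (HaarData.haar : Measure G)) =
        ∫ V, f₂ V ∂(fieldMeasure P (j + 1) G) := by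
    intro wZ
    set W₀ : GaugeField P j G := (FibreSplit.splitEquiv B (P := P) (G := G)).symm (wZ, fun _ => 1) with hW₀
    -- the frozen non-far part of the coarse field
    let x₀ : {c : PBond P (j + 1) // ¬ Far c} → G := fun c => axialAvg W₀ c.1
    -- the far part as reindexing + translation
    let T : ({c : PBond P (j + 1) // ¬¬ Far c} → G) → ({c : PBond P (j + 1) // ¬¬ Far c} → G) := fun v c => a c W₀ * v c * b c W₀
    have hT : MeasurePreserving T (Measure.pi fun _ : {c : PBond P (j + 1) // ¬¬ Far c} => (HaarData.haar : Measure G))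
        (Measure.pi fun _ : {c : PBond P (j + 1) // ¬¬ Far c} => (HaarData.haar : Measure G)) := by
      have h1 := measurePreserving_pi (fun _ : {c : PBond P (j + 1) // ¬¬ Far c} => (HaarData.haar : Measure G)) (fun _ => HaarData.haar)
        (f := fun c x => a c W₀ * x) (fun c => ⟨measurable_const_mul _, HaarData.map_mul_left _⟩)
      have h2 := measurePreserving_pi (fun _ : {c : PBond P (j + 1) // ¬¬ Far c} => (HaarData.haar : Measure G)) (fun _ => HaarData.haar)
        (f := fun c x => x * b c W₀) (fun c => ⟨measurable_mul_const _, HaarData.map_mul_right _⟩)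
      have hcomp : T = (fun (v : {c : PBond P (j + 1) // ¬¬ Far c} → G) c => v c * b c W₀) ∘ fun (v : {c : PBond P (j + 1) // ¬¬ Far c} → G) c => a c W₀ * v c := by
        funext v c; rfl
      rw [hcomp]; exact h2.comp h1
    have hr : MeasurePreserving (⇑(MeasurableEquiv.piCongrLeft (fun _ : {c : PBond P (j + 1) // ¬¬ Far c} => G) e.symm))
        (Measure.pi fun _ : {b : PBond P j // ¬¬ B b} => (HaarData.haar : Measure G))
        (Measure.pi fun _ : {c : PBond P (j + 1) // ¬¬ Far c} => (HaarData.haar : Measure G)) :=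
      measurePreserving_piCongrLeft (fun _ : {c : PBond P (j + 1) // ¬¬ Far c} => (HaarData.haar : Measure G)) e.symm
    -- the integrand factors through `joinC (x₀, T (r wB))`
    have hfun : ∀ wB : {b : PBond P j // ¬¬ B b} → G,
        f₂ (axialAvg ((FibreSplit.splitEquiv B (P := P) (G := G)).symm (wZ, wB))) =
          f₂ ((FibreSplit.splitEquiv Far (P := P) (G := G)).symm (x₀, T (MeasurableEquiv.piCongrLeft (fun _ : {c : PBond P (j + 1) // ¬¬ Far c} => G) e.symm wB))) := by
      intro wB
      refine hloc₂ _ _ fun c hc => ?_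
      rw [splitEquiv_symm_apply, dif_neg (not_not.2 hc)]
      show axialAvg _ c = a ⟨c, not_not.2 hc⟩ W₀ * (MeasurableEquiv.piCongrLeft (fun _ => G) e.symm wB) ⟨c, not_not.2 hc⟩ * b ⟨c, not_not.2 hc⟩ W₀
      rw [piCongrLeft_const_apply, Equiv.symm_symm]
      have hW : ∀ s, s < P.L → s ≠ τ c → ((FibreSplit.splitEquiv B (P := P) (G := G)).symm (wZ, wB)) (line c s) = W₀ (line c s) := by
        intro s hs hst
        refine hJ wZ wB _ ?_
        rintro ⟨c', hc', h⟩
        obtain ⟨h1, h2⟩ := line_inj hj (hτ c' hc') hs h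
        subst h1
        exact hst h2.symm
      obtain ⟨ha', hb'⟩ := hinv ⟨c, not_not.2 hc⟩ _ _ hW
      rw [hab ⟨c, not_not.2 hc⟩, ha', hb']
      have hsel : ((FibreSplit.splitEquiv B (P := P) (G := G)).symm (wZ, wB)) (line c (τ c)) = wB (e ⟨c, not_not.2 hc⟩) := by
        rw [splitEquiv_symm_apply, dif_neg (not_not.2 ⟨c, hc, rfl⟩)]
        rfl
      rw [hsel]
    simp_rw [hfun]
    have hmp := hT.comp hr
    have hmeas_g : Measurable fun v : {c : PBond P (j + 1) // ¬¬ Far c} → G => f₂ ((FibreSplit.splitEquiv Far (P := P) (G := G)).symm (x₀, v)) :=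
      hf₂.comp ((FibreSplit.splitEquiv Far (P := P) (G := G)).symm.measurable.comp (measurable_const.prodMk measurable_id))
    rw [← integral_far_eq Far f₂ hf₂ C₂ hC₂ hloc₂ x₀, ← hmp.map_eq, integral_map hmp.measurable.aemeasurable hmeas_g.aestronglyMeasurable]
    rfl
  -- (iv) assemble by Fubini
  have hbd₁ : ∀ U, |f₁ (axialAvg U)| ≤ C₁ := fun U => hC₁ _
  have hint₁ : Integrable (fun U => ρ U * f₁ (axialAvg U)) (fieldMeasure P j G) :=
    hρ.mul_bdd (hf₁.comp measurable_axialAvg).aestronglyMeasurable (Filter.Eventually.of_forall fun U => by rw [Real.norm_eq_abs]; exact hbd₁ U)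
  have hint₁₂ : Integrable (fun U => ρ U * (f₁ (axialAvg U) * f₂ (axialAvg U))) (fieldMeasure P j G) := by
    refine hρ.mul_bdd ((hf₁.comp measurable_axialAvg).mul (hf₂.comp measurable_axialAvg)).aestronglyMeasurable
      (c := C₁ * C₂) (Filter.Eventually.of_forall fun U => ?_)
    rw [Real.norm_eq_abs, abs_mul]
    have h0 : 0 ≤ C₁ := (abs_nonneg _).trans (hC₁ (axialAvg U))
    exact mul_le_mul (hC₁ _) (hC₂ _) (abs_nonneg _) h0
  rw [FibreSplit.integral_fieldMeasure_split B _ hint₁₂, FibreSplit.integral_fieldMeasure_split B _ hint₁]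
  have hinner₁ : ∀ wZ : {b : PBond P j // ¬ B b} → G,
      ∫ wB, ρ ((FibreSplit.splitEquiv B (P := P) (G := G)).symm (wZ, wB)) * f₁ (axialAvg ((FibreSplit.splitEquiv B (P := P) (G := G)).symm (wZ, wB)))
        ∂(Measure.pi fun _ : {b : PBond P j // ¬¬ B b} => (HaarData.haar : Measure G)) =
      ρ ((FibreSplit.splitEquiv B (P := P) (G := G)).symm (wZ, fun _ => 1)) * f₁ (axialAvg ((FibreSplit.splitEquiv B (P := P) (G := G)).symm (wZ, fun _ => 1))) := by
    intro wZ
    simp_rw [hρc wZ, hf₁c wZ]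
    rw [integral_const, probReal_univ, one_smul]
  have hinner₁₂ : ∀ wZ : {b : PBond P j // ¬ B b} → G,
      ∫ wB, ρ ((FibreSplit.splitEquiv B (P := P) (G := G)).symm (wZ, wB)) *
          (f₁ (axialAvg ((FibreSplit.splitEquiv B (P := P) (G := G)).symm (wZ, wB))) * f₂ (axialAvg ((FibreSplit.splitEquiv B (P := P) (G := G)).symm (wZ, wB))))
        ∂(Measure.pi fun _ : {b : PBond P j // ¬¬ B b} => (HaarData.haar : Measure G)) =
      ρ ((FibreSplit.splitEquiv B (P := P) (G := G)).symm (wZ, fun _ => 1)) * f₁ (axialAvg ((FibreSplit.splitEquiv B (P := P) (G := G)).symm (wZ, fun _ => 1))) *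
        ∫ V, f₂ V ∂(fieldMeasure P (j + 1) G) := by
    intro wZ
    simp_rw [hρc wZ, hf₁c wZ, ← mul_assoc]
    rw [integral_const_mul, hfar wZ]
  simp_rw [hinner₁, hinner₁₂]
  rw [integral_mul_const]

/-- ★★★ **THE GENERAL FORM: along the axial average, a coarse observable may be replaced by its FAR-AVERAGE** — with `Far`, `τ`, `ρ` as above (ρ integrable, local off the
far-selected bonds), for every bounded measurable `f` on the coarse fields: `∫ ρ(U)·f(Ū) dU = ∫ ρ(U)·(A f)(Ū) dU`, where `(A f)(V) := ∫ f(joinC(V↾Farᶜ, v)) dHaar^{Far}(v)` is the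
average of `f` over the far coarse variables (written inline; no definition).  So CONDITIONALLY ON EVERYTHING NEAR, the far coarse variables are product Haar.
[cite: Balaban1985UV3, (10) p.258 + (48)–(49) p.268 (bookkeeping); Balaban1985Averaging, (15) p.19] -/
theorem integral_mul_comp_axial_eq_farAvg (hj : j + 1 ≤ P.m + P.K) (Far : PBond P (j + 1) → Prop) [DecidablePred Far] (τ : PBond P (j + 1) → ℕ)
    (hτ : ∀ c, Far c → τ c < P.L) [DecidablePred fun b : PBond P j => ∃ c, Far c ∧ line c (τ c) = b]
    (ρ : Density P j G) (hρ : Integrable ρ (fieldMeasure P j G))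
    (hloc : ∀ W W' : GaugeField P j G, (∀ b, (¬ ∃ c, Far c ∧ line c (τ c) = b) → W b = W' b) → ρ W = ρ W')
    (f : GaugeField P (j + 1) G → ℝ) (hf : Measurable f) (C : ℝ) (hC : ∀ V, |f V| ≤ C) :
    ∫ U, ρ U * f (axialAvg U) ∂(fieldMeasure P j G) =
      ∫ U, ρ U * (∫ v, f ((FibreSplit.splitEquiv Far (P := P) (G := G)).symm ((FibreSplit.splitEquiv Far (P := P) (G := G) (axialAvg U)).1, v))
        ∂(Measure.pi fun _ : {c : PBond P (j + 1) // ¬¬ Far c} => (HaarData.haar : Measure G))) ∂(fieldMeasure P j G) := by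
  set B : PBond P j → Prop := fun b => ∃ c, Far c ∧ line c (τ c) = b with hB
  -- the far-average as a function of the coarse field, bounded and measurable
  set Af : GaugeField P (j + 1) G → ℝ := fun V => ∫ v, f ((FibreSplit.splitEquiv Far (P := P) (G := G)).symm ((FibreSplit.splitEquiv Far (P := P) (G := G) V).1, v))
        ∂(Measure.pi fun _ : {c : PBond P (j + 1) // ¬¬ Far c} => (HaarData.haar : Measure G)) with hAf
  have hF : Measurable fun p : ({c : PBond P (j + 1) // ¬ Far c} → G) × ({c : PBond P (j + 1) // ¬¬ Far c} → G) =>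
      f ((FibreSplit.splitEquiv Far (P := P) (G := G)).symm p) := hf.comp (FibreSplit.splitEquiv Far (P := P) (G := G)).symm.measurable
  have hAf_meas : Measurable Af := by
    have h1 : StronglyMeasurable fun x : {c : PBond P (j + 1) // ¬ Far c} → G =>
        ∫ v, f ((FibreSplit.splitEquiv Far (P := P) (G := G)).symm (x, v)) ∂(Measure.pi fun _ : {c : PBond P (j + 1) // ¬¬ Far c} => (HaarData.haar : Measure G)) :=
      hF.stronglyMeasurable.integral_prod_right'
    exact h1.measurable.comp (measurable_fst.comp (FibreSplit.splitEquiv Far (P := P) (G := G)).measurable)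
  have hAf_bdd : ∀ V, |Af V| ≤ C := by
    intro V
    have h0 : 0 ≤ C := (abs_nonneg _).trans (hC V)
    refine (abs_integral_le_integral_abs).trans ?_
    calc ∫ v, |f ((FibreSplit.splitEquiv Far (P := P) (G := G)).symm ((FibreSplit.splitEquiv Far (P := P) (G := G) V).1, v))|
          ∂(Measure.pi fun _ : {c : PBond P (j + 1) // ¬¬ Far c} => (HaarData.haar : Measure G))
        ≤ ∫ _v, C ∂(Measure.pi fun _ : {c : PBond P (j + 1) // ¬¬ Far c} => (HaarData.haar : Measure G)) :=
          integral_mono_of_nonneg (Filter.Eventually.of_forall fun _ => abs_nonneg _) (integrable_const C)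
            (Filter.Eventually.of_forall fun _ => hC _)
      _ = C := by rw [integral_const, probReal_univ, one_smul]
  -- `Af` is local off `Far`: it reads `V` only through `V↾Farᶜ`
  have hAf_loc : ∀ V V' : GaugeField P (j + 1) G, (∀ c, ¬ Far c → V c = V' c) → Af V = Af V' := by
    intro V V' hVV'
    have : (FibreSplit.splitEquiv Far (P := P) (G := G) V).1 = (FibreSplit.splitEquiv Far (P := P) (G := G) V').1 := by
      funext c; exact hVV' c.1 c.2
    simp only [hAf, this]
  -- abbreviations for the fine join and its frozen version
  have hJ : ∀ (wZ : {b : PBond P j // ¬ B b} → G) (wB : {b : PBond P j // ¬¬ B b} → G) (b : PBond P j), ¬ B b →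
      (FibreSplit.splitEquiv B (P := P) (G := G)).symm (wZ, wB) b = (FibreSplit.splitEquiv B (P := P) (G := G)).symm (wZ, fun _ => 1) b := by
    intro wZ wB b hb
    rw [splitEquiv_symm_apply, splitEquiv_symm_apply, dif_pos hb, dif_pos hb]
  have hρc : ∀ (wZ : {b : PBond P j // ¬ B b} → G) (wB : {b : PBond P j // ¬¬ B b} → G),
      ρ ((FibreSplit.splitEquiv B (P := P) (G := G)).symm (wZ, wB)) = ρ ((FibreSplit.splitEquiv B (P := P) (G := G)).symm (wZ, fun _ => 1)) :=
    fun wZ wB => hloc _ _ fun b hb => hJ wZ wB b hb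
  have hnotB : ∀ c, ¬ Far c → ∀ s, s < P.L → ¬ B (line c s) := by
    rintro c hc s hs ⟨c', hc', h⟩
    obtain ⟨h1, -⟩ := line_inj hj (hτ c' hc') hs h
    exact hc (h1 ▸ hc')
  have hnear : ∀ (wZ : {b : PBond P j // ¬ B b} → G) (wB : {b : PBond P j // ¬¬ B b} → G) (c : PBond P (j + 1)), ¬ Far c →
      axialAvg ((FibreSplit.splitEquiv B (P := P) (G := G)).symm (wZ, wB)) c = axialAvg ((FibreSplit.splitEquiv B (P := P) (G := G)).symm (wZ, fun _ => 1)) c :=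
    fun wZ wB c hc => axialAvg_congr_line c fun s hs => hJ wZ wB _ (hnotB c hc s hs)
  have hAfc : ∀ (wZ : {b : PBond P j // ¬ B b} → G) (wB : {b : PBond P j // ¬¬ B b} → G),
      Af (axialAvg ((FibreSplit.splitEquiv B (P := P) (G := G)).symm (wZ, wB))) = Af (axialAvg ((FibreSplit.splitEquiv B (P := P) (G := G)).symm (wZ, fun _ => 1))) :=
    fun wZ wB => hAf_loc _ _ fun c hc => hnear wZ wB c hc
  -- the far coarse variables: reindexing + two-sided translation of fresh Haar variables
  have hsel_inj : ∀ c c', Far c → Far c' → line c (τ c) = line c' (τ c') → c = c' :=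
    fun c c' hc hc' h => (line_inj hj (hτ c hc) (hτ c' hc') h).1
  let e : {c : PBond P (j + 1) // ¬¬ Far c} ≃ {b : PBond P j // ¬¬ B b} :=
    Equiv.ofBijective (fun c => ⟨line c.1 (τ c.1), not_not.2 ⟨c.1, not_not.1 c.2, rfl⟩⟩)
      ⟨fun c c' h => Subtype.ext (hsel_inj c.1 c'.1 (not_not.1 c.2) (not_not.1 c'.2) (congrArg Subtype.val h)), fun b => by
        obtain ⟨c, hc, hcb⟩ := not_not.1 b.2
        exact ⟨⟨c, not_not.2 hc⟩, Subtype.ext hcb⟩⟩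
  choose a b hab hinv using fun c : {c : PBond P (j + 1) // ¬¬ Far c} => pathProd_split (P := P) (G := G) c.1 (hτ c.1 (not_not.1 c.2))
  -- KEY: the inner integral of `f(axial J)` over the far-selected variables is the far-average at the frozen field
  have hfar : ∀ (wZ : {b : PBond P j // ¬ B b} → G),
      ∫ wB, f (axialAvg ((FibreSplit.splitEquiv B (P := P) (G := G)).symm (wZ, wB))) ∂(Measure.pi fun _ : {b : PBond P j // ¬¬ B b} => (HaarData.haar : Measure G)) =
        ∫ v, f ((FibreSplit.splitEquiv Far (P := P) (G := G)).symm
          ((FibreSplit.splitEquiv Far (P := P) (G := G) (axialAvg ((FibreSplit.splitEquiv B (P := P) (G := G)).symm (wZ, fun _ => 1)))).1, v))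
          ∂(Measure.pi fun _ : {c : PBond P (j + 1) // ¬¬ Far c} => (HaarData.haar : Measure G)) := by
    intro wZ
    set W₀ : GaugeField P j G := (FibreSplit.splitEquiv B (P := P) (G := G)).symm (wZ, fun _ => 1) with hW₀
    let T : ({c : PBond P (j + 1) // ¬¬ Far c} → G) → ({c : PBond P (j + 1) // ¬¬ Far c} → G) := fun v c => a c W₀ * v c * b c W₀
    have hT : MeasurePreserving T (Measure.pi fun _ : {c : PBond P (j + 1) // ¬¬ Far c} => (HaarData.haar : Measure G))
        (Measure.pi fun _ : {c : PBond P (j + 1) // ¬¬ Far c} => (HaarData.haar : Measure G)) := by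
      have h1 := measurePreserving_pi (fun _ : {c : PBond P (j + 1) // ¬¬ Far c} => (HaarData.haar : Measure G)) (fun _ => HaarData.haar)
        (f := fun c x => a c W₀ * x) (fun c => ⟨measurable_const_mul _, HaarData.map_mul_left _⟩)
      have h2 := measurePreserving_pi (fun _ : {c : PBond P (j + 1) // ¬¬ Far c} => (HaarData.haar : Measure G)) (fun _ => HaarData.haar)
        (f := fun c x => x * b c W₀) (fun c => ⟨measurable_mul_const _, HaarData.map_mul_right _⟩)
      have hcomp : T = (fun (v : {c : PBond P (j + 1) // ¬¬ Far c} → G) c => v c * b c W₀) ∘ fun (v : {c : PBond P (j + 1) // ¬¬ Far c} → G) c => a c W₀ * v c := by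
        funext v c; rfl
      rw [hcomp]; exact h2.comp h1
    have hr : MeasurePreserving (⇑(MeasurableEquiv.piCongrLeft (fun _ : {c : PBond P (j + 1) // ¬¬ Far c} => G) e.symm))
        (Measure.pi fun _ : {b : PBond P j // ¬¬ B b} => (HaarData.haar : Measure G))
        (Measure.pi fun _ : {c : PBond P (j + 1) // ¬¬ Far c} => (HaarData.haar : Measure G)) :=
      measurePreserving_piCongrLeft (fun _ : {c : PBond P (j + 1) // ¬¬ Far c} => (HaarData.haar : Measure G)) e.symm
    -- the frozen near part is the first component of the split of `axial W₀`
    have hx₀ : ∀ wB : {b : PBond P j // ¬¬ B b} → G,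
        f (axialAvg ((FibreSplit.splitEquiv B (P := P) (G := G)).symm (wZ, wB))) =
          f ((FibreSplit.splitEquiv Far (P := P) (G := G)).symm ((FibreSplit.splitEquiv Far (P := P) (G := G) (axialAvg W₀)).1,
            T (MeasurableEquiv.piCongrLeft (fun _ : {c : PBond P (j + 1) // ¬¬ Far c} => G) e.symm wB))) := by
      intro wB
      congr 1
      funext c
      rw [splitEquiv_symm_apply]
      by_cases hc : ¬ Far c
      · rw [dif_pos hc]
        exact hnear wZ wB c hc
      · rw [dif_neg hc]
        have hc' : Far c := not_not.1 hc
        show axialAvg _ c = a ⟨c, hc⟩ W₀ * (MeasurableEquiv.piCongrLeft (fun _ => G) e.symm wB) ⟨c, hc⟩ * b ⟨c, hc⟩ W₀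
        rw [piCongrLeft_const_apply, Equiv.symm_symm]
        have hW : ∀ s, s < P.L → s ≠ τ c → ((FibreSplit.splitEquiv B (P := P) (G := G)).symm (wZ, wB)) (line c s) = W₀ (line c s) := by
          intro s hs hst
          refine hJ wZ wB _ ?_
          rintro ⟨c', hc'', h⟩
          obtain ⟨h1, h2⟩ := line_inj hj (hτ c' hc'') hs h
          subst h1
          exact hst h2.symm
        obtain ⟨ha', hb'⟩ := hinv ⟨c, hc⟩ _ _ hW
        rw [hab ⟨c, hc⟩, ha', hb']
        have hsel : ((FibreSplit.splitEquiv B (P := P) (G := G)).symm (wZ, wB)) (line c (τ c)) = wB (e ⟨c, hc⟩) := by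
          rw [splitEquiv_symm_apply, dif_neg (not_not.2 ⟨c, hc', rfl⟩)]
          rfl
        rw [hsel]
    simp_rw [hx₀]
    have hmp := hT.comp hr
    have hmeas_g : Measurable fun v : {c : PBond P (j + 1) // ¬¬ Far c} → G =>
        f ((FibreSplit.splitEquiv Far (P := P) (G := G)).symm ((FibreSplit.splitEquiv Far (P := P) (G := G) (axialAvg W₀)).1, v)) :=
      hF.comp (measurable_const.prodMk measurable_id)
    rw [← hmp.map_eq, integral_map hmp.measurable.aemeasurable hmeas_g.aestronglyMeasurable]
    rfl
  -- assemble by Fubini on both sides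
  have hint : Integrable (fun U => ρ U * f (axialAvg U)) (fieldMeasure P j G) :=
    hρ.mul_bdd (hf.comp measurable_axialAvg).aestronglyMeasurable (Filter.Eventually.of_forall fun U => by rw [Real.norm_eq_abs]; exact hC _)
  have hintA : Integrable (fun U => ρ U * Af (axialAvg U)) (fieldMeasure P j G) :=
    hρ.mul_bdd (hAf_meas.comp measurable_axialAvg).aestronglyMeasurable (Filter.Eventually.of_forall fun U => by rw [Real.norm_eq_abs]; exact hAf_bdd _)
  show ∫ U, ρ U * f (axialAvg U) ∂(fieldMeasure P j G) = ∫ U, ρ U * Af (axialAvg U) ∂(fieldMeasure P j G)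
  rw [FibreSplit.integral_fieldMeasure_split B _ hint, FibreSplit.integral_fieldMeasure_split B _ hintA]
  refine integral_congr_ae (Filter.Eventually.of_forall fun wZ => ?_)
  show ∫ wB, ρ _ * f (axialAvg _) ∂_ = ∫ wB, ρ _ * Af (axialAvg _) ∂_
  simp_rw [hρc wZ, hAfc wZ]
  rw [integral_const_mul, hfar wZ, integral_const, probReal_univ, one_smul]

end FarFresh

end Summit.QuantumFields.YangMills.BalabanUVNodes.N08AxialDecimationFarFresh

end
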